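import Mathlib
import Summits.Ventures.HodgeRepro2.CanonicalAutomorphyFactor
import Summits.Ventures.HodgeRepro2.BallAnalytic

/-!
# The weight-`k` slash operator on the ball

Kernel annex of the blind cell `pub-hodge-repro2` (seat p2), Tier-3 hypothesis shapes of
`Hypothesis.lean`.  Shimura's automorphic forms of weight `k` (Sh79 §5) are the functions fixed
by the slash operators `(f |ₖ α)(z) = j(α, z)^{−k} f(αz)`.  This file records:

* `slash k α f`; `slash_one`; **`slash_mul`** (`f |ₖ (αβ) = (f |ₖ α) |ₖ β` on the ball — the
  cocycle relation of `CanonicalAutomorphyFactor.lean`), so the slash operators form a right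
  action of `U(2,1)` on functions on the ball;
* `slash_add` / `slash_smul` (linearity in `f`);
* **`slash_eq_self_iff`**: `f |ₖ α = f` at `z` iff `f(αz) = j(α, z)^k f(z)` — automorphic forms of
  weight `k` are exactly the holomorphic functions fixed by the slash operators (`IsSlashFixed`,
  `isSlashFixed_iff`);
* `differentiableOn_slash`: the slash of a holomorphic function by `α ∈ U(2,1)` is holomorphic;
  `IsSlashFixed.slash_mem`: the slash by a normalising `α` preserves the fixed functions.
-/

namespace Summit.Ventures.HodgeRepro2.ShimuraData

/-- The slash operator of weight `k`: `(f |ₖ α)(z) = j(α, z)^{−k} · f(αz)`. -/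
noncomputable def slash (k : ℕ) (α : Matrix (Fin 3) (Fin 3) ℂ) (f : (Fin 2 → ℂ) → ℂ)
    (z : Fin 2 → ℂ) : ℂ :=
  (autFactor α z ^ k)⁻¹ * f (ballAction α z)

/-- `f |ₖ 1 = f`. -/
theorem slash_one (k : ℕ) (f : (Fin 2 → ℂ) → ℂ) : slash k 1 f = f := by
  funext z
  simp [slash, autFactor_one, ballAction_one]

/-- **The slash operators form a right action** (on the ball): `f |ₖ (αβ) = (f |ₖ α) |ₖ β`. -/
theorem slash_mul (k : ℕ) {α β : Matrix (Fin 3) (Fin 3) ℂ} (hβ : IsInU21 β)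
    (f : (Fin 2 → ℂ) → ℂ) {z : Fin 2 → ℂ} (hz : z ∈ ball₂) :
    slash k (α * β) f z = slash k β (slash k α f) z := by
  simp only [slash, hβ.ballAction_mul hz, hβ.autFactor_mul hz, mul_pow, mul_inv]
  ring

/-- The slash operator is additive in `f`. -/
theorem slash_add (k : ℕ) (α : Matrix (Fin 3) (Fin 3) ℂ) (f g : (Fin 2 → ℂ) → ℂ) :
    slash k α (f + g) = slash k α f + slash k α g := by
  funext z
  simp [slash, mul_add]

/-- The slash operator commutes with scalars. -/
theorem slash_smul (k : ℕ) (α : Matrix (Fin 3) (Fin 3) ℂ) (c : ℂ) (f : (Fin 2 → ℂ) → ℂ) :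
    slash k α (c • f) = c • slash k α f := by
  funext z
  simp only [slash, Pi.smul_apply, smul_eq_mul]
  ring

/-- `f |ₖ α = f` at `z` iff `f(αz) = j(α, z)^k f(z)` (for `j(α, z) ≠ 0`). -/
theorem slash_eq_self_iff {k : ℕ} {α : Matrix (Fin 3) (Fin 3) ℂ} {f : (Fin 2 → ℂ) → ℂ}
    {z : Fin 2 → ℂ} (hD : autFactor α z ≠ 0) :
    slash k α f z = f z ↔ f (ballAction α z) = autFactor α z ^ k * f z := by
  rw [slash]
  constructor
  · intro h
    rw [← h]
    field_simp
  · intro h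
    rw [h]
    field_simp

/-- `f` is fixed by the slash operators of weight `k` of a set `Γ'` (on the ball). -/
def IsSlashFixed (Γ' : Set (Matrix (Fin 3) (Fin 3) ℂ)) (k : ℕ) (f : (Fin 2 → ℂ) → ℂ) : Prop :=
  ∀ γ ∈ Γ', ∀ z ∈ ball₂, slash k γ f z = f z

/-- **Fixed by the slash operators ⟺ the weight-`k` transformation law** (for `Γ' ⊆ U(2,1)`):
`f |ₖ γ = f` on the ball for all `γ ∈ Γ'` iff `f(γz) = j(γ, z)^k f(z)` for all `γ ∈ Γ'`, `z ∈ 𝔹²`. -/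
theorem isSlashFixed_iff {Γ' : Set (Matrix (Fin 3) (Fin 3) ℂ)} (hΓ' : ∀ γ ∈ Γ', IsInU21 γ)
    (k : ℕ) (f : (Fin 2 → ℂ) → ℂ) :
    IsSlashFixed Γ' k f ↔ ∀ γ ∈ Γ', ∀ z ∈ ball₂, f (ballAction γ z) = autFactor γ z ^ k * f z := by
  constructor
  · intro h γ hγ z hz
    exact (slash_eq_self_iff ((hΓ' γ hγ).autFactor_ne_zero hz)).1 (h γ hγ z hz)
  · intro h γ hγ z hz
    exact (slash_eq_self_iff ((hΓ' γ hγ).autFactor_ne_zero hz)).2 (h γ hγ z hz)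

/-- The automorphy factor is holomorphic in `z` (it is affine). -/
theorem differentiable_autFactor (α : Matrix (Fin 3) (Fin 3) ℂ) :
    Differentiable ℂ (autFactor α) :=
  (contDiff_mulVec_homog_apply α (Fin.last 2)).differentiable (by simp)

/-- The slash of a holomorphic function by `α ∈ U(2,1)` is holomorphic on the ball. -/
theorem differentiableOn_slash (k : ℕ) {α : Matrix (Fin 3) (Fin 3) ℂ} (hα : IsInU21 α)
    {f : (Fin 2 → ℂ) → ℂ} (hf : DifferentiableOn ℂ f ball₂) :
    DifferentiableOn ℂ (slash k α f) ball₂ := by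
  intro z hz
  have hD := hα.autFactor_ne_zero hz
  have h1 : DifferentiableAt ℂ (fun w => (autFactor α w ^ k)⁻¹) z :=
    ((differentiable_autFactor α).differentiableAt.pow k).inv (pow_ne_zero k hD)
  have h2 : DifferentiableAt ℂ (fun w => f (ballAction α w)) z :=
    ((hf _ (hα.ballAction_mem_ball₂ hz)).differentiableAt
      (isOpen_ball₂.mem_nhds (hα.ballAction_mem_ball₂ hz))).comp z (hα.differentiableAt_ballAction hz)
  exact (h1.mul h2).differentiableWithinAt

/-- The slash operator only sees the values of `f` on the ball. -/
theorem slash_congr {k : ℕ} {α : Matrix (Fin 3) (Fin 3) ℂ} (hα : IsInU21 α)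
    {f g : (Fin 2 → ℂ) → ℂ} (h : ∀ w ∈ ball₂, f w = g w) {z : Fin 2 → ℂ} (hz : z ∈ ball₂) :
    slash k α f z = slash k α g z := by
  simp only [slash, h _ (hα.ballAction_mem_ball₂ hz)]

/-- The slash operator by a normalising element `α` preserves the functions fixed by the slash
operators of `Γ' ⊆ U(2,1)` (stated for `α` with `α γ = γ' α`, `γ' ∈ Γ'`, for every `γ ∈ Γ'`). -/
theorem IsSlashFixed.slash_mem {Γ' : Set (Matrix (Fin 3) (Fin 3) ℂ)}
    (hΓ' : ∀ γ ∈ Γ', IsInU21 γ) {k : ℕ} {f : (Fin 2 → ℂ) → ℂ} (hf : IsSlashFixed Γ' k f)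
    {α : Matrix (Fin 3) (Fin 3) ℂ} (hα : IsInU21 α)
    (hnorm : ∀ γ ∈ Γ', ∃ γ' ∈ Γ', α * γ = γ' * α) :
    IsSlashFixed Γ' k (slash k α f) := by
  intro γ hγ z hz
  obtain ⟨γ', hγ', hγγ'⟩ := hnorm γ hγ
  rw [← slash_mul k (hΓ' γ hγ) f hz, hγγ', slash_mul k hα f hz]
  exact slash_congr hα (fun w hw => hf γ' hγ' w hw) hz

end Summit.Ventures.HodgeRepro2.ShimuraData
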